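import Summits.HodgeConjecture.HodgeConjecture.Theorems.R90S4TwistedNormMapLocal    -- ★ (K2E3-p27 g2, p861787): `IsEpsNormPair`, `epsLoc` laws (brings ★ `Ch4Sec10`, ★ `R90S4TwistedNormMap`, ★ `R90S4LocalBaseChangeDefs`)
import Literature.NumberTheory.Rogawski1990.LocalTransfer                           -- ★ `stableOrbitalIntegralRel`, `IsRegularElt`, `IsStablyConj` (via `StableConjugacyU3`)
import Literature.NumberTheory.Rogawski1990.LocalTransferFundamentalLemma           -- ★ `IsLocSmooth` (`C_c^∞`)
import HarnessLib

/-!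
# R90-TF §S4 — FILE C support: THE LOCAL ε-TWISTED TRANSFER RELATION `φ → f` (Rogawski 1990, §4.10 (4.10.1)–(4.10.2), Prop. 4.10.1 (a))

S4 dealer K2E2-plan (g6) cand for `Theorems/R90S4TwistedTransferDefs.lean` (hand S4#C-TT; one home for the C-D2 definitions of the
S4 SOCKET PLAN).  DEFINITIONS + unfolding lemmas only; no socket, no `sorry`.  Everything generic is ★ already
(`Literature.NumberTheory.Rogawski1990.Ch4Sec10` §1–§2: ε-conjugacy `IsEpsConj`, `epsCentralizer`, the norm map `epsNorm`, the twisted orbital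
integral `epsOrbitalIntegral`, the ε-classes `EpsConjClassesMod ε Z′`, families `EpsOrbitalMeasureFamily`, (4.10.1) `epsKappaOrbitalIntegral`;
`R90S4TwistedNormMap{,Local}`: `IsEpsNormPair` = «`γ ∈ 𝒩(δ)`»); this file is the INSTANCE at the S4 carriers

* `G̃_v = GtLoc L v = GL₃(L ⊗_{L⁺} L⁺_v)` with `ε_v = epsLoc L Φ v` (★ `twistLocal` = ★ `Ch4Sec10.unitaryTwist (conjLocal …) (formLocal L 3 Φ v)`, rfl),
* `G_v = (UnitaryGroup.cmDatum L 3 ↑Φ).Local v ⊂ G̃_v`.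

## Contents
* §1 `IsEpsRegularAt` («`δ` is ε-regular»: `N(δ) = δ ε(δ)` regular semisimple, ★ `IsRegularElt`), `IsStablyEpsConjAt` (stable ε-conjugacy =
  `GL₃`-conjugacy of norms, Prop. 3.11.1 (c)), `IsStablyConjGAt` (stable conjugacy in `G_v` = conjugacy in `G̃_v`, §3.1) — each with the `Iff.rfl`
  bridge to the ★ `Ch4Sec10` ∕ `StableConjugacyU3` token it instantiates.
* §2 `stableEpsOrbitalIntegral mGt φ δ = Φ^{st}_ε(δ, φ)` := ★ `epsKappaOrbitalIntegral` at `κ = 1`, `e ≡ 1`, `Z′ = ⊥` (see CONVENTION), and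
  **`IsEpsTransferPair mGt mG φ f`** — «`φ → f`» (4.10.2): `Φ^{st}_ε(δ, φ) = Φ^{st}(γ, f)` for every ε-regular `δ` and every `γ ∈ 𝒩(δ)`.
* §3 the two NAMED EXISTENCE INPUTS of Prop. 4.10.1 (a) on test functions (`C_c^∞` = ★ `IsLocSmooth` on both sides):
  `IsLocalEpsTransferExists` («for `φ` there exists `f` with `φ → f`») and `IsLocalEpsCoTransferExists` («conversely, for `f` there exists `φ`»).
  They are HYPOTHESES of the S4 sockets (JQ-S4-A6: no section of R90-TF proves §4.10–4.12 today); no socket quantifies over the relation.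

## EDITION 2 (S4 dealer, junction fix — statements otherwise byte-identical)
The measure-bearing sections §2–§3 are now GENERIC in the σ-algebras of the orbit spaces: instance binders
`[∀ δ, MeasurableSpace (G̃_v ⧸ G̃_{δε})]` and `[∀ γ, MeasurableSpace (G_v ⧸ G_{v,γ})]` replace ED. 1's group-level `[MeasurableSpace G̃_v]` ∕
`[MeasurableSpace G_v]` (from which ED. 1 silently synthesised the QUOTIENT σ-algebras `QuotientGroup.measurableSpace`, so that the Lines-A
convention «orbit spaces carry their BOREL σ-algebra» (`letI := borel _`, ★ `OrbitalMeasureFamily.IsCanonical`) could not be passed in —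
dealer probe `inst_probe.lean`: «Application type mismatch … expected … fun δ => QuotientGroup.measurableSpace …»).  Every explicit signature
(`stableEpsOrbitalIntegral L Φ v mGt φ δ`, `IsEpsTransferPair L Φ v mGt mG φ f`, `IsLocalEps(Co)TransferExists L Φ v mGt mG`) is unchanged.

## CONVENTION (honest deviation from print, = the programme's `C_c` convention of record, as in S3 ∕ ★ `Ch4Sec10` §1 ∕ ★ Kottwitz1992)
Print works in `C(G̃, ω̃)` (smooth, compactly supported MODULO THE CENTRE, fixed central character), integrates over `G̃(δε)″ \ G̃` and indexes
the stable ε-class by `𝒟_ε(δ∕F)` «modulo multiplication by `F^*`» [§3.11 p. 35; §4.10 p. 57].  Here test functions are `C_c^∞(G̃_v)` ∕ `C_c^∞(G_v)`,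
the twisted orbital integral is over `G̃_v ⧸ G̃_{δε}` (★ `epsOrbitalIntegral`), and `Φ^{st}_ε(δ, ·)` sums over ALL ε-classes `δ′` with `N(δ′)`
conjugate to `N(δ)` (`Z′ = ⊥`; finitely many for local `F`, not claimed — ★ `finsum` convention `= 0` otherwise); the Kottwitz signs `e(δ′) = e(G̃_{δ′ε})`
are `1` at ε-REGULAR `δ′` (the ε-centraliser is a torus), the only arguments at which (4.10.2) is evaluated, so `e ≡ 1` is exact there.  The orbital
measure families `mGt`, `mG` are PARAMETERS (normalisations are hypotheses of the consumers, as ★ `OrbitalMeasureFamily.IsCanonical` is for S3).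
[cite: Rogawski1990, §4.10 (4.10.1)–(4.10.2), Prop. 4.10.1 (a) pp. 57–58; §3.11 Prop. 3.11.1 (c) pp. 34–35; §3.1 p. 19; §1.6 pp. 5–6]
[cite: Kottwitz1992, §16 p. 432]
-/

noncomputable section

open MeasureTheory
open scoped NumberField MatrixGroups

set_option linter.dupNamespace false

namespace Summit.HodgeConjecture.HodgeConjecture.R90.S4

open Literature.NumberTheory.Rogawski1990
open Literature.NumberTheory.Rogawski1990.Ch4Sec10
open Literature.NumberTheory.Automorphic
open IsDedekindDomain NumberField
open Summit.HodgeConjecture.HodgeConjecture.Cruxes.H413.K2E1GlobalTestFunctionsTwisted (formLocal twistLocal)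

/-! ## §1 ε-regular elements, stable ε-conjugacy, stable conjugacy in `G_v` [§3.1, §3.11] -/
section Classes

variable (L : Type) [Field L] [NumberField L] [IsCMField L] (Φ : GL (Fin 3) L)
  (v : HeightOneSpectrum (𝓞 ↥(maximalRealSubfield L)))

/-- **`δ ∈ G̃_v` is ε-regular**: «if `𝒩(δ)` consists of regular elements» — the norm `N(δ) = δ ε_v(δ)` (★ `epsNorm (epsLoc L Φ v)`) is regular
semisimple (★ `IsRegularElt`: separable characteristic polynomial). [cite: Rogawski1990, §3.11 p. 34; §3.1 p. 19] -/
def IsEpsRegularAt (δ : GtLoc L v) : Prop :=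
  IsRegularElt (epsNorm (epsLoc L Φ v) δ)

/-- Unfolding of `IsEpsRegularAt`. [cite: Rogawski1990, §3.11 p. 34] -/
theorem isEpsRegularAt_iff (δ : GtLoc L v) : IsEpsRegularAt L Φ v δ ↔ IsRegularElt (epsNorm (epsLoc L Φ v) δ) := Iff.rfl

/-- `IsEpsRegularAt` IS ★ `Ch4Sec10.IsEpsRegular` at `σ_v = conjLocal`, `Φ_v = formLocal L 3 Φ v` (`epsLoc = twistLocal = unitaryTwist …`, rfl).
[cite: Rogawski1990, §3.11 p. 34] -/
theorem isEpsRegularAt_iff_isEpsRegular (δ : GtLoc L v) :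
    IsEpsRegularAt L Φ v δ ↔
      Ch4Sec10.IsEpsRegular (UnitaryGroup.conjLocal L (IsCMField.complexConj L) v) (formLocal L 3 Φ v) δ :=
  Iff.rfl

/-- **Stable ε-conjugacy in `G̃_v`**: `δ, δ′` are stably ε-conjugate iff their norms are `G̃_v`-conjugate («the norm map defines a bijection between
`𝒪_{ε-st}(G̃)` and `𝒪_{st}(G)`», Prop. 3.11.1 (c); = ★ `Ch4Sec10.IsStablyEpsConj` at the local data, rfl). [cite: Rogawski1990, §3.11 Prop. 3.11.1 (c) p. 34] -/
def IsStablyEpsConjAt (δ δ' : GtLoc L v) : Prop :=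
  IsConj (epsNorm (epsLoc L Φ v) δ) (epsNorm (epsLoc L Φ v) δ')

/-- Unfolding of `IsStablyEpsConjAt`. [cite: Rogawski1990, §3.11 Prop. 3.11.1 (c) p. 34] -/
theorem isStablyEpsConjAt_iff (δ δ' : GtLoc L v) :
    IsStablyEpsConjAt L Φ v δ δ' ↔ IsConj (epsNorm (epsLoc L Φ v) δ) (epsNorm (epsLoc L Φ v) δ') := Iff.rfl

/-- `IsStablyEpsConjAt` IS ★ `Ch4Sec10.IsStablyEpsConj` at the local data (rfl). [cite: Rogawski1990, §3.11 Prop. 3.11.1 (c) p. 34] -/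
theorem isStablyEpsConjAt_iff_isStablyEpsConj (δ δ' : GtLoc L v) :
    IsStablyEpsConjAt L Φ v δ δ' ↔
      Ch4Sec10.IsStablyEpsConj (UnitaryGroup.conjLocal L (IsCMField.complexConj L) v) (formLocal L 3 Φ v) δ δ' :=
  Iff.rfl

variable {L Φ v} in
/-- Stable ε-conjugacy is reflexive. [cite: Rogawski1990, §3.11 p. 34] -/
theorem IsStablyEpsConjAt.refl (δ : GtLoc L v) : IsStablyEpsConjAt L Φ v δ δ := IsConj.refl _

variable {L Φ v} in
/-- Stable ε-conjugacy is symmetric. [cite: Rogawski1990, §3.11 p. 34] -/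
theorem IsStablyEpsConjAt.symm {δ δ' : GtLoc L v} (h : IsStablyEpsConjAt L Φ v δ δ') : IsStablyEpsConjAt L Φ v δ' δ := IsConj.symm h

variable {L Φ v} in
/-- Stable ε-conjugacy is transitive. [cite: Rogawski1990, §3.11 p. 34] -/
theorem IsStablyEpsConjAt.trans {δ δ' δ'' : GtLoc L v} (h : IsStablyEpsConjAt L Φ v δ δ') (h' : IsStablyEpsConjAt L Φ v δ' δ'') :
    IsStablyEpsConjAt L Φ v δ δ'' := IsConj.trans h h'

variable {L Φ v} in
/-- Two elements with a common norm `γ ∈ 𝒩(δ) ∩ 𝒩(δ′)` are stably ε-conjugate. [cite: Rogawski1990, §3.11 Prop. 3.11.1 (c) p. 34] -/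
theorem isStablyEpsConjAt_of_isEpsNormPair {δ δ' : GtLoc L v} {γ : (UnitaryGroup.cmDatum L 3 (Φ : Matrix (Fin 3) (Fin 3) L)).Local v}
    (h : IsEpsNormPair L Φ v δ γ) (h' : IsEpsNormPair L Φ v δ' γ) : IsStablyEpsConjAt L Φ v δ δ' :=
  IsConj.trans h (IsConj.symm h')

/-- **Stable conjugacy in `G_v`**: `γ, γ′ ∈ G_v` are stably conjugate iff they are conjugate in the ambient `G̃_v = GL₃(L ⊗ L⁺_v)` — the
tree's currency ★ `IsStablyConj` («`δ = g⁻¹γg` for some `g ∈ G(F̄)`», §3.1), spelled on the `cmDatum` carrier. [cite: Rogawski1990, §3.1 p. 19] -/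
def IsStablyConjGAt (γ γ' : (UnitaryGroup.cmDatum L 3 (Φ : Matrix (Fin 3) (Fin 3) L)).Local v) : Prop :=
  IsConj (γ.val : GtLoc L v) (γ'.val : GtLoc L v)

/-- Unfolding of `IsStablyConjGAt`. [cite: Rogawski1990, §3.1 p. 19] -/
theorem isStablyConjGAt_iff (γ γ' : (UnitaryGroup.cmDatum L 3 (Φ : Matrix (Fin 3) (Fin 3) L)).Local v) :
    IsStablyConjGAt L Φ v γ γ' ↔ IsConj (γ.val : GtLoc L v) (γ'.val : GtLoc L v) := Iff.rfl

variable {L Φ v} in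
/-- `𝒩(δ)` is a union of stable classes: `γ ∈ 𝒩(δ)`, `γ ∼_{st} γ′` ⇒ `γ′ ∈ 𝒩(δ)` (★ `isEpsNormPair_of_isConj_val`).
[cite: Rogawski1990, §3.11 p. 34] -/
theorem IsEpsNormPair.of_isStablyConjGAt {δ : GtLoc L v} {γ γ' : (UnitaryGroup.cmDatum L 3 (Φ : Matrix (Fin 3) (Fin 3) L)).Local v}
    (h : IsEpsNormPair L Φ v δ γ) (hγ : IsStablyConjGAt L Φ v γ γ') : IsEpsNormPair L Φ v δ γ' :=
  IsConj.trans h hγ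

end Classes

/-! ## §2 `Φ^{st}_ε(δ, φ)` and the relation «`φ → f`» (4.10.2) [§4.10 pp. 57–58] -/
section TwistedStable

variable (L : Type) [Field L] [NumberField L] [IsCMField L] (Φ : GL (Fin 3) L)
  (v : HeightOneSpectrum (𝓞 ↥(maximalRealSubfield L)))
  [∀ δ : GtLoc L v, MeasurableSpace (GtLoc L v ⧸ epsCentralizer (epsLoc L Φ v) δ)]

/-- **`Φ^{st}_ε(δ, φ) = Σ_{δ′} Φ_ε(δ′, φ)`**, the stable ε-twisted orbital integral of `φ ∈ C_c(G̃_v)` at `δ`: ★ (4.10.1) `epsKappaOrbitalIntegral`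
at `κ = 1`, `e ≡ 1`, `Z′ = ⊥` (CONVENTION in the module docstring) — the `finsum` over the ε-classes `c` of `G̃_v` whose representative is stably
ε-conjugate to `δ` of `Φ_ε(out c, φ) = ∫_{G̃_v ⧸ G̃_{δ′ε}} φ(y δ′ ε(y)⁻¹) d(mGt c)`. [cite: Rogawski1990, §4.10 (4.10.1) p. 57] -/
def stableEpsOrbitalIntegral (mGt : EpsOrbitalMeasureFamily (epsLoc L Φ v) ⊥) (φ : GtLoc L v → ℂ) (δ : GtLoc L v) : ℂ :=
  epsKappaOrbitalIntegral (epsLoc L Φ v) (IsStablyEpsConjAt L Φ v) (fun _ _ => 1) (fun _ => 1) mGt φ δ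

/-- Unfolding of `stableEpsOrbitalIntegral`. [cite: Rogawski1990, §4.10 (4.10.1) p. 57] -/
theorem stableEpsOrbitalIntegral_def (mGt : EpsOrbitalMeasureFamily (epsLoc L Φ v) ⊥) (φ : GtLoc L v → ℂ) (δ : GtLoc L v) :
    stableEpsOrbitalIntegral L Φ v mGt φ δ =
      epsKappaOrbitalIntegral (epsLoc L Φ v) (IsStablyEpsConjAt L Φ v) (fun _ _ => 1) (fun _ => 1) mGt φ δ := rfl

/-- `Φ^{st}_ε(δ, φ)` as the bare `finsum` of twisted class orbital integrals. [cite: Rogawski1990, §4.10 (4.10.1) p. 57] -/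
theorem stableEpsOrbitalIntegral_eq_finsum (mGt : EpsOrbitalMeasureFamily (epsLoc L Φ v) ⊥) (φ : GtLoc L v → ℂ) (δ : GtLoc L v) :
    stableEpsOrbitalIntegral L Φ v mGt φ δ =
      ∑ᶠ c ∈ {c : EpsConjClassesMod (epsLoc L Φ v) ⊥ | IsStablyEpsConjAt L Φ v δ (Quotient.out c)},
        classEpsOrbitalIntegral (epsLoc L Φ v) mGt φ c := by
  simp only [stableEpsOrbitalIntegral, epsKappaOrbitalIntegral, one_mul]

/-- `Φ^{st}_ε(δ, 0) = 0`. [cite: Rogawski1990, §4.10 (4.10.1) p. 57] -/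
@[simp] theorem stableEpsOrbitalIntegral_zero (mGt : EpsOrbitalMeasureFamily (epsLoc L Φ v) ⊥) (δ : GtLoc L v) :
    stableEpsOrbitalIntegral L Φ v mGt (0 : GtLoc L v → ℂ) δ = 0 := by
  rw [stableEpsOrbitalIntegral_eq_finsum]
  refine finsum_eq_zero_of_forall_eq_zero fun c => ?_
  classical
  rw [finsum_eq_if]
  split_ifs
  · simp [classEpsOrbitalIntegral, epsOrbitalIntegral, descEpsConj]
  · rfl

end TwistedStable

section Transfer

variable (L : Type) [Field L] [NumberField L] [IsCMField L] (Φ : GL (Fin 3) L)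
  (v : HeightOneSpectrum (𝓞 ↥(maximalRealSubfield L)))
  [∀ δ : GtLoc L v, MeasurableSpace (GtLoc L v ⧸ epsCentralizer (epsLoc L Φ v) δ)]
  [∀ γ : (UnitaryGroup.cmDatum L 3 (Φ : Matrix (Fin 3) (Fin 3) L)).Local v,
    MeasurableSpace ((UnitaryGroup.cmDatum L 3 (Φ : Matrix (Fin 3) (Fin 3) L)).Local v ⧸
      Subgroup.centralizer ({γ} : Set ((UnitaryGroup.cmDatum L 3 (Φ : Matrix (Fin 3) (Fin 3) L)).Local v)))]

/-- **«`φ → f`» (4.10.2)**: `Φ^{st}_ε(δ, φ) = Φ^{st}(γ, f)` «for all ε-regular semisimple `δ ∈ G̃` and `γ ∈ 𝒩(δ)`» — `Φ^{st}(γ, f)` the tree's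
★ `stableOrbitalIntegralRel` for stable conjugacy in `G_v` (§1 `IsStablyConjGAt`) and the orbital measure family `mG`; `Φ^{st}_ε` as above for `mGt`.
[cite: Rogawski1990, §4.10 (4.10.2), Prop. 4.10.1 (a) p. 58] -/
def IsEpsTransferPair (mGt : EpsOrbitalMeasureFamily (epsLoc L Φ v) ⊥)
    (mG : OrbitalMeasureFamily ((UnitaryGroup.cmDatum L 3 (Φ : Matrix (Fin 3) (Fin 3) L)).Local v))
    (φ : GtLoc L v → ℂ) (f : (UnitaryGroup.cmDatum L 3 (Φ : Matrix (Fin 3) (Fin 3) L)).Local v → ℂ) : Prop :=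
  ∀ δ : GtLoc L v, IsEpsRegularAt L Φ v δ →
    ∀ γ : (UnitaryGroup.cmDatum L 3 (Φ : Matrix (Fin 3) (Fin 3) L)).Local v, IsEpsNormPair L Φ v δ γ →
      stableEpsOrbitalIntegral L Φ v mGt φ δ = stableOrbitalIntegralRel (IsStablyConjGAt L Φ v) mG f γ

/-- Unfolding of `IsEpsTransferPair`. [cite: Rogawski1990, §4.10 (4.10.2) p. 58] -/
theorem isEpsTransferPair_iff (mGt : EpsOrbitalMeasureFamily (epsLoc L Φ v) ⊥)
    (mG : OrbitalMeasureFamily ((UnitaryGroup.cmDatum L 3 (Φ : Matrix (Fin 3) (Fin 3) L)).Local v))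
    (φ : GtLoc L v → ℂ) (f : (UnitaryGroup.cmDatum L 3 (Φ : Matrix (Fin 3) (Fin 3) L)).Local v → ℂ) :
    IsEpsTransferPair L Φ v mGt mG φ f ↔
      ∀ δ : GtLoc L v, IsEpsRegularAt L Φ v δ →
        ∀ γ : (UnitaryGroup.cmDatum L 3 (Φ : Matrix (Fin 3) (Fin 3) L)).Local v, IsEpsNormPair L Φ v δ γ →
          stableEpsOrbitalIntegral L Φ v mGt φ δ = stableOrbitalIntegralRel (IsStablyConjGAt L Φ v) mG f γ :=
  Iff.rfl

/-- `0 → 0`. [cite: Rogawski1990, §4.10 (4.10.2) p. 58] -/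
theorem isEpsTransferPair_zero (mGt : EpsOrbitalMeasureFamily (epsLoc L Φ v) ⊥)
    (mG : OrbitalMeasureFamily ((UnitaryGroup.cmDatum L 3 (Φ : Matrix (Fin 3) (Fin 3) L)).Local v)) :
    IsEpsTransferPair L Φ v mGt mG (0 : GtLoc L v → ℂ) (0 : (UnitaryGroup.cmDatum L 3 (Φ : Matrix (Fin 3) (Fin 3) L)).Local v → ℂ) := by
  intro δ _ γ _
  rw [stableEpsOrbitalIntegral_zero, stableOrbitalIntegralRel_zero]

variable {L Φ v} in
/-- The right-hand side of (4.10.2) depends on `γ ∈ 𝒩(δ)` only through its stable class — consistency of the definition: if `f` has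
stably-invariant stable orbital integrals (the case for every `f`, since `Φ^{st}` sums over the stable class; recorded as a hypothesis here, no
finiteness claimed) then the identity at one norm gives it at every norm. [cite: Rogawski1990, §4.10 p. 58; §3.11 p. 34] -/
theorem IsEpsTransferPair.eq_of_isEpsNormPair {mGt : EpsOrbitalMeasureFamily (epsLoc L Φ v) ⊥}
    {mG : OrbitalMeasureFamily ((UnitaryGroup.cmDatum L 3 (Φ : Matrix (Fin 3) (Fin 3) L)).Local v)}
    {φ : GtLoc L v → ℂ} {f : (UnitaryGroup.cmDatum L 3 (Φ : Matrix (Fin 3) (Fin 3) L)).Local v → ℂ}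
    (h : IsEpsTransferPair L Φ v mGt mG φ f) {δ : GtLoc L v} (hδ : IsEpsRegularAt L Φ v δ)
    {γ : (UnitaryGroup.cmDatum L 3 (Φ : Matrix (Fin 3) (Fin 3) L)).Local v} (hγ : IsEpsNormPair L Φ v δ γ) :
    stableEpsOrbitalIntegral L Φ v mGt φ δ = stableOrbitalIntegralRel (IsStablyConjGAt L Φ v) mG f γ :=
  h δ hδ γ hγ

end Transfer

/-! ## §3 Prop. 4.10.1 (a): existence of the transfers on test functions — NAMED INPUTS [§4.10 p. 58; §4.12 p. 60] -/
section Existence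

variable (L : Type) [Field L] [NumberField L] [IsCMField L] (Φ : GL (Fin 3) L)
  (v : HeightOneSpectrum (𝓞 ↥(maximalRealSubfield L)))
  [∀ δ : GtLoc L v, MeasurableSpace (GtLoc L v ⧸ epsCentralizer (epsLoc L Φ v) δ)]
  [∀ γ : (UnitaryGroup.cmDatum L 3 (Φ : Matrix (Fin 3) (Fin 3) L)).Local v,
    MeasurableSpace ((UnitaryGroup.cmDatum L 3 (Φ : Matrix (Fin 3) (Fin 3) L)).Local v ⧸
      Subgroup.centralizer ({γ} : Set ((UnitaryGroup.cmDatum L 3 (Φ : Matrix (Fin 3) (Fin 3) L)).Local v)))]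

/-- **Prop. 4.10.1 (a), first clause, on `C_c^∞`**: «Let `φ ∈ C(G̃, ω̃)`. Then there exists a function `f ∈ C(G, ω)` such that (4.10.2) holds» —
for every test function `φ` on `G̃_v` (★ `IsLocSmooth`) a test function `f` on `G_v` with `φ → f`.  A NAMED INPUT of the S4 sockets (the relation of
record is thereby TOTAL on smooth `φ`, audit S4#C0 P11-1∕P11-2); print proves it in §4.12 from [L1]. [cite: Rogawski1990, §4.10 Prop. 4.10.1 (a) p. 58; §4.12 p. 60] -/
def IsLocalEpsTransferExists (mGt : EpsOrbitalMeasureFamily (epsLoc L Φ v) ⊥)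
    (mG : OrbitalMeasureFamily ((UnitaryGroup.cmDatum L 3 (Φ : Matrix (Fin 3) (Fin 3) L)).Local v)) : Prop :=
  ∀ φ : GtLoc L v → ℂ, IsLocSmooth φ →
    ∃ f : (UnitaryGroup.cmDatum L 3 (Φ : Matrix (Fin 3) (Fin 3) L)).Local v → ℂ, IsLocSmooth f ∧ IsEpsTransferPair L Φ v mGt mG φ f

/-- Unfolding of `IsLocalEpsTransferExists`. [cite: Rogawski1990, §4.10 Prop. 4.10.1 (a) p. 58] -/
theorem isLocalEpsTransferExists_iff (mGt : EpsOrbitalMeasureFamily (epsLoc L Φ v) ⊥)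
    (mG : OrbitalMeasureFamily ((UnitaryGroup.cmDatum L 3 (Φ : Matrix (Fin 3) (Fin 3) L)).Local v)) :
    IsLocalEpsTransferExists L Φ v mGt mG ↔
      ∀ φ : GtLoc L v → ℂ, IsLocSmooth φ →
        ∃ f : (UnitaryGroup.cmDatum L 3 (Φ : Matrix (Fin 3) (Fin 3) L)).Local v → ℂ, IsLocSmooth f ∧ IsEpsTransferPair L Φ v mGt mG φ f :=
  Iff.rfl

/-- **Prop. 4.10.1 (a), converse clause, on `C_c^∞`**: «Conversely, if `f ∈ C(G, ω)`, there exists `φ ∈ C(G̃, ω̃)` such that (4.10.2) holds» —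
a NAMED INPUT of the S4 sockets (surjectivity of the transfer onto test functions of `G_v`, used for the injectivity of `ψ_G`, Thm. 13.2.1).
[cite: Rogawski1990, §4.10 Prop. 4.10.1 (a) p. 58; §4.12 p. 60] -/
def IsLocalEpsCoTransferExists (mGt : EpsOrbitalMeasureFamily (epsLoc L Φ v) ⊥)
    (mG : OrbitalMeasureFamily ((UnitaryGroup.cmDatum L 3 (Φ : Matrix (Fin 3) (Fin 3) L)).Local v)) : Prop :=
  ∀ f : (UnitaryGroup.cmDatum L 3 (Φ : Matrix (Fin 3) (Fin 3) L)).Local v → ℂ, IsLocSmooth f →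
    ∃ φ : GtLoc L v → ℂ, IsLocSmooth φ ∧ IsEpsTransferPair L Φ v mGt mG φ f

/-- Unfolding of `IsLocalEpsCoTransferExists`. [cite: Rogawski1990, §4.10 Prop. 4.10.1 (a) p. 58] -/
theorem isLocalEpsCoTransferExists_iff (mGt : EpsOrbitalMeasureFamily (epsLoc L Φ v) ⊥)
    (mG : OrbitalMeasureFamily ((UnitaryGroup.cmDatum L 3 (Φ : Matrix (Fin 3) (Fin 3) L)).Local v)) :
    IsLocalEpsCoTransferExists L Φ v mGt mG ↔
      ∀ f : (UnitaryGroup.cmDatum L 3 (Φ : Matrix (Fin 3) (Fin 3) L)).Local v → ℂ, IsLocSmooth f →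
        ∃ φ : GtLoc L v → ℂ, IsLocSmooth φ ∧ IsEpsTransferPair L Φ v mGt mG φ f :=
  Iff.rfl

end Existence

end Summit.HodgeConjecture.HodgeConjecture.R90.S4

end
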